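import Literature.Geometry.Lorentzian.KerrSchild
import Literature.Geometry.Lorentzian.ChronologyViolation
import HarnessLib

/-!
# The homogeneous vacuum plane wave and its null boosts
(topic `Geometry/Lorentzian`; Brinkmann 1925 / Baldwin–Jeffery 1926 plane waves in Kerr–Schild
form, Ehlers–Kundt 1962 §2-5; the boost invariance used in Geroch 1969, "Limits of spacetimes",
and in Penrose's plane-wave limit)

The **homogeneous vacuum plane wave** on `ℝ⁴`, in Kerr–Schild form with a CONSTANT null covector:
`g = η + H ℓ ⊗ ℓ`, `ℓ = dx⁰ − dx³` (`η`-null), `H(x) = (x¹)² − (x²)²` (harmonic in the transverse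
plane, so `g` is Ricci flat; `R_{u1u1} = −R_{u2u2} ≠ 0`, so `g` is NOT flat). As for every
Kerr–Schild metric, `g(v, w) = η(A v, A w)` for the shear `A v = v + ½H ℓ(v) ℓ♯` (`ℓ(ℓ♯) = 0`),
which exhibits the Lorentzian signature; `T = A⁻¹ ∂₀` is a smooth timelike field (`g(T,T) = −1`).
This gives the bundled `PlaneWave.spacetime : Spacetime 4` with carrier `E4`.

The **null boosts** `boost c : (u, v, x¹, x²) ↦ (c u, v / c, x¹, x²)` (`u = x⁰ − x³ = ℓ(x)`,
`v = x⁰ + x³`), `c ≠ 0`, are linear `η`-isometries fixing the profile `H` and scaling `ℓ` by `c`;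
hence the pulled-back plane wave is the plane wave of amplitude `c²`:
`g_{boost c x}(boost c v, boost c w) = η(v, w) + c² H(x) ℓ(v) ℓ(w)` (`bilin_boost`). As `c → 0`
these components converge to `η` with all derivatives, locally uniformly — the mechanism behind
the non-uniqueness of limits of spacetimes (Geroch 1969, §3) exploited in
`PlaneWaveMinkowskiLimit.lean`.

## References
* R. Geroch, *Limits of spacetimes*, Comm. Math. Phys. 13 (1969) 180–193, §3.
* J. Ehlers, W. Kundt, *Exact solutions of the gravitational field equations*, in: Gravitation
  (L. Witten ed.), Wiley 1962, §2-5 (plane-fronted waves).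
* [KerrSchild1965] R. P. Kerr, A. Schild, Proc. Symp. Appl. Math. 17 (1965), §2.
-/

noncomputable section

open TopologicalSpace Manifold Set Function Bundle
open scoped ContDiff Topology

namespace Literature.Geometry.Lorentzian

namespace PlaneWave

/-! ### Null coordinates and the profile -/

/-- The constant null covector `ℓ = dx⁰ − dx³` (`u`-coordinate differential). [cite: KerrSchild1965, §2] -/
def ell : E4 →L[ℝ] ℝ := E4.dx 0 - E4.dx 3

/-- `ℓ(v) = v⁰ − v³`. [folklore] -/
@[simp]
theorem ell_apply (v : E4) : ell v = v 0 - v 3 := by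
  simp [ell]

/-- The conjugate null covector `n = dx⁰ + dx³` (`v`-coordinate differential). [folklore] -/
def enn : E4 →L[ℝ] ℝ := E4.dx 0 + E4.dx 3

/-- `n(v) = v⁰ + v³`. [folklore] -/
@[simp]
theorem enn_apply (v : E4) : enn v = v 0 + v 3 := by
  simp [enn]

/-- The `η`-dual null vector `ℓ♯ = −(∂₀ + ∂₃)` of `ℓ` (`η(ℓ♯, w) = ℓ(w)`, `ℓ(ℓ♯) = 0`). [cite: KerrSchild1965, §2] -/
def ellSharp : E4 := -(E4.basisVector 0 + E4.basisVector 3)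

/-- Components of `ℓ♯`. [folklore] -/
@[simp] theorem ellSharp_zero : ellSharp 0 = -1 := by simp [ellSharp]

/-- Components of `ℓ♯`. [folklore] -/
@[simp] theorem ellSharp_one : ellSharp 1 = 0 := by simp [ellSharp, Fin.ext_iff]

/-- Components of `ℓ♯`. [folklore] -/
@[simp] theorem ellSharp_two : ellSharp 2 = 0 := by simp [ellSharp, Fin.ext_iff]

/-- Components of `ℓ♯`. [folklore] -/
@[simp] theorem ellSharp_three : ellSharp 3 = -1 := by simp [ellSharp, Fin.ext_iff]

/-- `ℓ(ℓ♯) = 0`: `ℓ♯` is `ℓ`-null. [cite: KerrSchild1965, §2] -/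
@[simp]
theorem ell_ellSharp : ell ellSharp = 0 := by
  simp

/-- `η(v, ℓ♯) = ℓ(v)`. [cite: KerrSchild1965, §2] -/
@[simp]
theorem bilin_ellSharp_right (v : E4) : Minkowski.bilin v ellSharp = ell v := by
  simp [Fin.sum_univ_three]
  ring

/-- `η(ℓ♯, w) = ℓ(w)`. [cite: KerrSchild1965, §2] -/
@[simp]
theorem bilin_ellSharp_left (w : E4) : Minkowski.bilin ellSharp w = ell w := by
  rw [Minkowski.bilin_symm, bilin_ellSharp_right]

/-- `η` in null coordinates: `η(v, w) = −½(ℓ(v) n(w) + n(v) ℓ(w)) + v¹w¹ + v²w²`. [folklore] -/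
theorem minkowski_bilin_eq (v w : E4) : Minkowski.bilin v w =
    -(ell v * enn w + enn v * ell w) / 2 + v 1 * w 1 + v 2 * w 2 := by
  simp [Fin.sum_univ_three]
  ring

/-- The **profile** `H(x) = (x¹)² − (x²)²` of the homogeneous vacuum plane wave (harmonic in the
transverse coordinates). [folklore] -/
def profile (x : E4) : ℝ := x 1 ^ 2 - x 2 ^ 2

/-- The profile in terms of the coordinate covectors. [folklore] -/
theorem profile_eq : profile = fun x ↦ E4.dx 1 x ^ 2 - E4.dx 2 x ^ 2 := by
  funext x
  simp [profile]

/-- The profile is analytic (a polynomial). [folklore] -/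
theorem contDiff_profile : ContDiff ℝ ω profile := by
  rw [profile_eq]
  exact ((E4.dx 1).contDiff.pow 2).sub ((E4.dx 2).contDiff.pow 2)

/-! ### The metric components -/

/-- The **plane-wave metric components** `g_x = η + H(x) ℓ ⊗ ℓ`. [cite: KerrSchild1965, §2] -/
def bilin (x : E4) : E4 →L[ℝ] E4 →L[ℝ] ℝ := Minkowski.bilin + E4.tmul (profile x • ell) ell

/-- `g_x(v, w) = η(v, w) + H(x) ℓ(v) ℓ(w)`. [cite: KerrSchild1965, §2] -/
@[simp]
theorem bilin_apply (x v w : E4) :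
    bilin x v w = Minkowski.bilin v w + profile x * (ell v * ell w) := by
  simp only [bilin, E4.tmul, add_apply, ContinuousLinearMap.smulRight_apply, FunLike.coe_smul,
    Pi.smul_apply, smul_eq_mul]
  ring

/-- `g_x` is symmetric. [folklore] -/
theorem bilin_symm (x v w : E4) : bilin x v w = bilin x w v := by
  rw [bilin_apply, bilin_apply, Minkowski.bilin_symm, mul_comm (ell v)]

/-- The **Kerr–Schild shear** `A_x v = v + ½H(x) ℓ(v) ℓ♯`. [cite: KerrSchild1965, §2] -/
def shear (x v : E4) : E4 := v + (profile x / 2 * ell v) • ellSharp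

/-- `g_x(v, w) = η(A_x v, A_x w)`: the plane wave is a sheared Minkowski metric pointwise, which
exhibits its Lorentzian signature. [cite: KerrSchild1965, §2] -/
theorem bilin_eq_bilin_shear (x v w : E4) :
    bilin x v w = Minkowski.bilin (shear x v) (shear x w) := by
  simp only [shear, map_add, map_smul, add_apply, FunLike.coe_smul, Pi.smul_apply, bilin_apply,
    bilin_ellSharp_right, bilin_ellSharp_left, ell_ellSharp, smul_eq_mul]
  ring

/-- `v ↦ v − ½Hℓ(v)ℓ♯` is a right inverse of the shear. [cite: KerrSchild1965, §2] -/
theorem shear_sub_smul (x v : E4) : shear x (v - (profile x / 2 * ell v) • ellSharp) = v := by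
  simp [shear]

/-- The shear is injective. [cite: KerrSchild1965, §2] -/
theorem shear_eq_zero (x : E4) {v : E4} (hv : shear x v = 0) : v = 0 := by
  have hl : ell v = 0 := by simpa [shear] using congrArg ell hv
  simpa [shear, hl] using hv

/-- `g_x` is nondegenerate. [cite: KerrSchild1965, §2] -/
theorem bilin_nondegenerate (x v : E4) (hv : ∀ w, bilin x v w = 0) : v = 0 := by
  have hl : ell v = 0 := by
    have := hv ellSharp
    rwa [bilin_apply, bilin_ellSharp_right, ell_ellSharp, mul_zero, mul_zero, add_zero] at this
  exact Minkowski.bilin_nondegenerate v fun w ↦ by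
    have := hv w
    rwa [bilin_apply, hl, zero_mul, mul_zero, add_zero] at this

/-- The `g_x`-orthogonal complement of a `g_x`-timelike vector is spacelike (Lorentzian signature).
[cite: KerrSchild1965, §2] -/
theorem bilin_pos_of_orthogonal (x v w : E4) (hv : bilin x v v < 0) (hvw : bilin x v w = 0)
    (hw : w ≠ 0) : 0 < bilin x w w := by
  rw [bilin_eq_bilin_shear] at hv hvw ⊢
  exact Minkowski.bilin_pos_of_orthogonal _ _ hv hvw fun h ↦ hw (shear_eq_zero x h)

/-- The **orienting field** `T = A⁻¹ ∂₀ = ∂₀ − ½Hℓ(∂₀)ℓ♯`. [folklore] -/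
def timeVector (x : E4) : E4 :=
  E4.basisVector 0 - (profile x / 2 * ell (E4.basisVector 0)) • ellSharp

/-- `g(T, T) = η(∂₀, ∂₀) = −1`. [folklore] -/
theorem bilin_timeVector_timeVector (x : E4) : bilin x (timeVector x) (timeVector x) = -1 := by
  rw [bilin_eq_bilin_shear, timeVector, shear_sub_smul]
  exact Minkowski.bilin_basisVector_zero

/-- `g(T, w) = η(∂₀, A_x w) = −w⁰ + ½H(x) ℓ(w)` — the sign function of the orientation. [folklore] -/
theorem bilin_timeVector_left (x w : E4) :
    bilin x (timeVector x) w = -(w 0) + profile x / 2 * ell w := by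
  rw [bilin_eq_bilin_shear, timeVector, shear_sub_smul]
  simp only [shear, map_add, map_smul, Minkowski.bilin_basisVector_zero_left, bilin_ellSharp_right,
    smul_eq_mul, ell_apply]
  simp [Fin.ext_iff]

/-- The metric components are analytic in `x` (a polynomial field). [folklore] -/
theorem contDiff_bilin : ContDiff ℝ ω PlaneWave.bilin := by
  unfold PlaneWave.bilin E4.tmul
  exact contDiff_const.add ((contDiff_profile.smul contDiff_const).smulRight contDiff_const)

/-- The orienting field is analytic. [folklore] -/
theorem contDiff_timeVector : ContDiff ℝ ω timeVector := by
  unfold timeVector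
  exact contDiff_const.sub (((contDiff_profile.div_const 2).mul contDiff_const).smul contDiff_const)

/-- **The homogeneous vacuum plane wave** as an analytic Lorentzian metric on `E4`. [cite: KerrSchild1965, §2] -/
def metric : LorentzianMetric 𝓘(ℝ, E4) ω E4 where
  val x := bilin x
  symm x := bilin_symm x
  nondegenerate x := bilin_nondegenerate x
  contMDiff := ChronologyViolation.contMDiff_bilinSection contDiff_bilin
  exists_timelike x := ⟨timeVector x, (bilin_timeVector_timeVector x).trans_lt neg_one_lt_zero⟩
  pos_of_orthogonal x := bilin_pos_of_orthogonal x

/-- The metric at `x` is `bilin x`. [folklore] -/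
@[simp]
theorem metric_val (x : E4) : metric.val x = bilin x := rfl

/-- The **time orientation** `T = A⁻¹ ∂₀` of the plane wave. [folklore] -/
def timeOrientation : TimeOrientation metric where
  vectorField x := timeVector x
  isTimelike x := (bilin_timeVector_timeVector x).trans_lt neg_one_lt_zero
  contMDiff := contMDiff_vectorSpace_iff_contDiff.mpr contDiff_timeVector

/-- **The homogeneous vacuum plane wave** `(ℝ⁴, η + ((x¹)² − (x²)²)(dx⁰ − dx³)², T)` as a
bundled `Spacetime 4` with carrier `E4` (an `abbrev`, so that `spacetime.carrier` and its
instances are reducibly those of `E4`: the examples built on it work in the global chart). [cite: KerrSchild1965, §2] -/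
abbrev spacetime : Spacetime 4 where
  carrier := E4
  metric := metric.ofLE le_top
  timeOrientation := timeOrientation.ofLE le_top

/-- The carrier of the plane wave is `E4`. [folklore] -/
theorem spacetime_carrier : spacetime.carrier = E4 := rfl

/-- The metric of the bundled plane wave at `x` is `bilin x`. [folklore] -/
@[simp]
theorem spacetime_metric_val (x : E4) : spacetime.metric.val x = bilin x := rfl

/-- The orienting field of the bundled plane wave. [folklore] -/
@[simp]
theorem spacetime_vectorField (x : E4) : spacetime.timeOrientation.vectorField x = timeVector x :=
  rfl

/-! ### The null boosts -/

/-- The **null boost** `boost c : (u, v, x¹, x²) ↦ (c u, v/c, x¹, x²)`, as a continuous linear map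
of `E4` (`u = ℓ(x)`, `v = n(x)`; in `(x⁰, x³)` it is the Lorentz boost of rapidity `−log c`). [folklore] -/
def boost (c : ℝ) : E4 →L[ℝ] E4 :=
  ContinuousLinearMap.id ℝ E4 +
    (((c - 1) / 2) • ell + ((c⁻¹ - 1) / 2) • enn).smulRight (E4.basisVector 0) +
    (((c⁻¹ - 1) / 2) • enn - ((c - 1) / 2) • ell).smulRight (E4.basisVector 3)

/-- Components of the boosted vector. [folklore] -/
@[simp]
theorem boost_apply_zero (c : ℝ) (x : E4) : boost c x 0 = (c * ell x + c⁻¹ * enn x) / 2 := by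
  simp [boost, Fin.ext_iff]
  ring

/-- Components of the boosted vector. [folklore] -/
@[simp]
theorem boost_apply_one (c : ℝ) (x : E4) : boost c x 1 = x 1 := by
  simp [boost, Fin.ext_iff]

/-- Components of the boosted vector. [folklore] -/
@[simp]
theorem boost_apply_two (c : ℝ) (x : E4) : boost c x 2 = x 2 := by
  simp [boost, Fin.ext_iff]

/-- Components of the boosted vector. [folklore] -/
@[simp]
theorem boost_apply_three (c : ℝ) (x : E4) : boost c x 3 = (c⁻¹ * enn x - c * ell x) / 2 := by
  simp [boost, Fin.ext_iff]
  ring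

/-- The boost scales `ℓ` by `c`. [folklore] -/
@[simp]
theorem ell_boost (c : ℝ) (x : E4) : ell (boost c x) = c * ell x := by
  rw [ell_apply, boost_apply_zero, boost_apply_three]
  ring

/-- The boost scales `n` by `c⁻¹`. [folklore] -/
@[simp]
theorem enn_boost (c : ℝ) (x : E4) : enn (boost c x) = c⁻¹ * enn x := by
  rw [enn_apply, boost_apply_zero, boost_apply_three]
  ring

/-- The boost fixes the profile. [folklore] -/
@[simp]
theorem profile_boost (c : ℝ) (x : E4) : profile (boost c x) = profile x := by
  simp [profile]

/-- The boost is an `η`-isometry (`c ≠ 0`). [folklore] -/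
theorem minkowski_bilin_boost {c : ℝ} (hc : c ≠ 0) (v w : E4) :
    Minkowski.bilin (boost c v) (boost c w) = Minkowski.bilin v w := by
  rw [minkowski_bilin_eq, minkowski_bilin_eq, ell_boost, ell_boost, enn_boost, enn_boost,
    boost_apply_one, boost_apply_one, boost_apply_two, boost_apply_two]
  field_simp

/-- **The boosted plane wave is the plane wave of amplitude `c²`**:
`g_{boost c x}(boost c v, boost c w) = η(v, w) + c² H(x) ℓ(v) ℓ(w)`. [folklore] -/
theorem bilin_boost {c : ℝ} (hc : c ≠ 0) (x v w : E4) :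
    bilin (boost c x) (boost c v) (boost c w) =
      Minkowski.bilin v w + c ^ 2 * profile x * (ell v * ell w) := by
  rw [bilin_apply, minkowski_bilin_boost hc, profile_boost, ell_boost, ell_boost]
  ring

/-- `boost c⁻¹ ∘ boost c = id` for `c ≠ 0`. [folklore] -/
theorem boost_inv_boost {c : ℝ} (hc : c ≠ 0) (x : E4) : boost c⁻¹ (boost c x) = x := by
  ext μ
  fin_cases μ
  · show boost c⁻¹ (boost c x) 0 = x 0
    rw [boost_apply_zero, ell_boost, enn_boost, inv_inv, inv_mul_cancel_left₀ hc,
      mul_inv_cancel_left₀ hc, ell_apply, enn_apply]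
    ring
  · show boost c⁻¹ (boost c x) 1 = x 1
    rw [boost_apply_one, boost_apply_one]
  · show boost c⁻¹ (boost c x) 2 = x 2
    rw [boost_apply_two, boost_apply_two]
  · show boost c⁻¹ (boost c x) 3 = x 3
    rw [boost_apply_three, ell_boost, enn_boost, inv_inv, mul_inv_cancel_left₀ hc,
      inv_mul_cancel_left₀ hc, ell_apply, enn_apply]
    ring

/-- The boost fixes the origin. [folklore] -/
theorem boost_zero (c : ℝ) : boost c 0 = 0 := map_zero _

/-- The null boost as a continuous linear automorphism of `E4` (`c ≠ 0`). [folklore] -/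
def boostEquiv {c : ℝ} (hc : c ≠ 0) : E4 ≃L[ℝ] E4 :=
  ContinuousLinearEquiv.equivOfInverse (boost c) (boost c⁻¹) (boost_inv_boost hc) fun x ↦ by
    simpa using boost_inv_boost (inv_ne_zero hc) x

/-- The underlying map of `boostEquiv`. [folklore] -/
@[simp]
theorem boostEquiv_apply {c : ℝ} (hc : c ≠ 0) (x : E4) : boostEquiv hc x = boost c x := rfl

end PlaneWave

end Literature.Geometry.Lorentzian
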